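import Summits.AtomisticToContinuum.HydrodynamicLimit.Theorems.BoxDissipativeWeakStrongEntropyAdmissibilityStubGlobalEquilibriumEntropyBalance

/-!
# Crux `EntropyAdmissibility` (stmt-AtomisticToContinuum-9903), line `registered` — the crux HOLDS AT GLOBAL EQUILIBRIUM

Route `route-AtomisticToContinuum-BoxDissipativeWeakStrong`, sub-problem `HydrodynamicLimit`, crux
`Summit.AtomisticToContinuum.HydrodynamicLimit.Theses.BoxDissipativeWeakStrong.EntropyAdmissibility` (card K2: the clamp-renormalised LOCAL
entropy inequality of Březina–Feireisl, Def. 2.9, for the law of the hard-sphere BOX state, in expectation, zero defect: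
`E_{P_N}[(Q_N)⁺] → 0`, `Q_N = A_N + B_N`, `A_N = BDWS.dynPart`, `B_N = BDWS.initPart`).

This file lands the §3 theorems of the lead's skeleton r10 (`Cruxes/EntropyAdmissibility/Lines/birth.lean`) on the
GLOBAL-EQUILIBRIUM sub-frame `EABirthGE3.InFrameConst` — the crux's own quantifier frame `EABirthCore.InFrame` with the activity /
temperature / velocity profiles and the Euler state specialised to constants (so that `P_N` is the canonical global Gibbs law, invariant
under every hard-sphere flow, `map_flow_localGibbsLaw_const`). From the landed wave-1 stubs GE1 (`EABirthGE1`, static LLN for the two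
entropy functionals, p161002), GE2 (`EABirthGE2`, test-function transport identity, p160969) and GE3 (`EABirthGE3`, `A_N → −B` in
`L¹(P_N)` at global equilibrium — the entropy balance with EQUALITY, zero production: `EABirthGE3.inFrameConst_dynAbs`, p162417/p161932),
together with the landed S0 (`EABirthCore.inFrame_stat`) and S1a (`EABirthCore.inFrame_int`), it derives by sorry-free bookkeeping:

* `InFrameConst.of_inFrame` — the sub-frame IS the frame specialised (`InFrame C → InFrameConst C`); `inFrameConst_crux_of_crux`;
* `inFrameConst_def`  — the open heart S1b (`Cdef`: eventually `E[A_N] + B ≤ ε`) HOLDS at global equilibrium;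
* `inFrameConst_conc` — the open fluctuation statement S2 (`Cconc`: `E|A_N − E A_N| → 0`) HOLDS at global equilibrium;
* `inFrameConst_dyn`  — the dynamic core (`Cdyn`: `E[(A_N + B)⁺] → 0`) holds at global equilibrium;
* `inFrameConst_crux` — THE CRUX'S OWN CONCLUSION `Ccrux` (`E[(A_N + B_N)⁺] → 0`; `EABirthCore.entropyAdmissibility_iff_inFrame :
  crux ↔ InFrame Ccrux` is `Iff.rfl`) HOLDS on the global-equilibrium sub-frame — unconditionally, kernel-checked: every junk convention,
  the clamp, the Gibbs-consistent cut free energy, the flow axioms and the local Gibbs normalisation are exercised; only the genuinely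
  open positive-time dynamics away from equilibrium (S1b in general = the crux, p153795/p156387) is not.

Packaged as the registered bookkeeping stub `stub_globalEquilibriumConclusions : Sig.stub_globalEquilibriumConclusions`. Nothing here
restates the crux or the Statement; no `Prop` is taken as a hypothesis.

References: J. Březina, E. Feireisl, J. Math. Soc. Japan 70 (2018), Def. 2.9, §3.2; H. Spohn, *Large Scale Dynamics of Interacting
Particles* (1991), Part I §2.3 (equilibrium measures are flow-invariant), Ch. 3. Lead c2 `prover-line-stmt-AtomisticToContinuum-9903-c2-0`.
-/

noncomputable section

open MeasureTheory Filter Set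
open scoped ENNReal Topology

namespace Summit.AtomisticToContinuum.HydrodynamicLimit.Theorems.EABirthGE

open Literature.MathematicalPhysics.KineticTheory
open Literature.Analysis.FluidPDE.CompressibleEuler (clamp)
open Summit.AtomisticToContinuum.HydrodynamicLimit.Theses
open Summit.AtomisticToContinuum.HydrodynamicLimit.Theorems.BDWS
open Summit.AtomisticToContinuum.HydrodynamicLimit.Theorems.EABirthCore (Conclusion InFrame Ccrux Cdyn Cstat Cint Cdef Cconc
  inFrame_stat inFrame_int entropyAdmissibility_iff_inFrame tendsto_lintegral_ofReal_of_le_add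
  aemeasurable_ofReal_abs_initPart_sub)
open Summit.AtomisticToContinuum.HydrodynamicLimit.Theorems.EABirthS2bA (lintegral_ofReal_abs_sub_integral_le)
open Summit.AtomisticToContinuum.HydrodynamicLimit.Theorems.EABirthGE3 (InFrameConst CdynAbs inFrameConst_dynAbs)

/-! ## The sub-frame is the frame specialised; bookkeeping once -/

/-- **The global-equilibrium sub-frame IS the crux's frame specialised**: `InFrame C → InFrameConst C` (instantiate the
profiles and the Euler state at constants; `continuous_const`). -/
theorem InFrameConst.of_inFrame {C : Conclusion} (h : InFrame C) : InFrameConst C := by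
  intro hEos
  obtain ⟨ηc, hηc, H⟩ := h hEos
  refine ⟨ηc, hηc, fun η₁ hη₁ hη₁c ca cθ cu hca hcθ => ?_⟩
  obtain ⟨σ₀, hσ₀, G⟩ := H η₁ hη₁ hη₁c (fun _ => ca) (fun _ => cθ) (fun _ => cu) continuous_const continuous_const
    continuous_const (fun _ => hca) (fun _ => hcθ)
  exact ⟨σ₀, hσ₀, fun σ hσ hσlt T cρ cϑ cv hsol hguard Φ hLLN ℓ hℓ hℓ0 hℓ3 τ hτ a b hab φ hφ hφ0 =>
    G σ hσ hσlt T (fun _ _ => cρ) (fun _ _ => cϑ) (fun _ _ => cv) hsol hguard Φ hLLN ℓ hℓ hℓ0 hℓ3 τ hτ a b hab φ hφ hφ0⟩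

/-- The crux implies its global-equilibrium instance (so every `InFrameConst` theorem below is a special case of what the
crux asserts, proved unconditionally). -/
theorem inFrameConst_crux_of_crux (h : BoxDissipativeWeakStrong.EntropyAdmissibility) : InFrameConst Ccrux :=
  InFrameConst.of_inFrame (entropyAdmissibility_iff_inFrame.1 h)

/-- The sub-frame holds for the trivial conclusion. -/
theorem InFrameConst.of_true : InFrameConst fun _ _ _ _ _ _ _ _ _ _ _ _ _ _ _ => True :=
  fun _ => ⟨1, one_pos, fun _ _ _ _ _ _ _ _ => ⟨1, one_pos,
    fun _ _ _ _ _ _ _ _ _ _ _ _ _ _ _ _ _ _ _ _ _ _ _ => trivial⟩⟩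

/-- **Sub-frame bookkeeping, once (arity 3)** — the `InFrame.mono₃` of `EABirthCore` on the global-equilibrium sub-frame. -/
theorem InFrameConst.mono₃ {C₁ C₂ C₃ C₄ : Conclusion} {ηs σs : ℝ} (hηs : 0 < ηs) (hσs : 0 < σs)
    (h : ∀ (σ η₁ ca cθ : ℝ) (cu : V3) (T cρ cϑ : ℝ) (cv : V3) (Φ : FlowFamily σ) (ℓ : ℕ → ℝ) (τ a b : ℝ)
      (φ : ℝ → T3 → ℝ),
      0 < η₁ → η₁ < ηs → 0 < ca → 0 < cθ → 0 < σ → σ < σs →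
      IsHardSphereEulerSolution σ T (fun _ _ => cρ) (fun _ _ => cv) (fun _ _ => cϑ) →
      (∀ t ∈ Ico 0 T, ∀ _x : T3, cρ * σ ^ 3 ≤ η₁ / 2) →
      TendstoHydroFieldsAt (fun N => localGibbsLaw σ (fun _ => ca) (fun _ => cu) (fun _ => cθ) N (Φ N)) Φ
        (fun _ _ => cρ) (fun _ _ => cv) (fun _ _ => cϑ) 0 →
      (∀ N, 0 < ℓ N ∧ ℓ N ≤ 1) → Tendsto ℓ atTop (𝓝 0) → Tendsto (fun N : ℕ => ℓ N ^ 3 * ((N : ℝ) + 1)) atTop atTop →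
      τ ∈ Ico 0 T → a < b → Literature.Analysis.FunctionSpaces.Torus.IsSmoothSpaceTimeOn (Ico 0 T) φ →
      (∀ t ∈ Icc 0 τ, ∀ x, 0 ≤ φ t x) →
      C₁ σ η₁ (fun _ => ca) (fun _ => cθ) (fun _ => cu) T (fun _ _ => cρ) (fun _ _ => cϑ) (fun _ _ => cv) Φ ℓ τ a b φ →
      C₂ σ η₁ (fun _ => ca) (fun _ => cθ) (fun _ => cu) T (fun _ _ => cρ) (fun _ _ => cϑ) (fun _ _ => cv) Φ ℓ τ a b φ →
      C₃ σ η₁ (fun _ => ca) (fun _ => cθ) (fun _ => cu) T (fun _ _ => cρ) (fun _ _ => cϑ) (fun _ _ => cv) Φ ℓ τ a b φ →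
      C₄ σ η₁ (fun _ => ca) (fun _ => cθ) (fun _ => cu) T (fun _ _ => cρ) (fun _ _ => cϑ) (fun _ _ => cv) Φ ℓ τ a b φ)
    (h₁ : InFrameConst C₁) (h₂ : InFrameConst C₂) (h₃ : InFrameConst C₃) : InFrameConst C₄ := by
  intro hEos
  obtain ⟨η1, hη1, H1⟩ := h₁ hEos
  obtain ⟨η2, hη2, H2⟩ := h₂ hEos
  obtain ⟨η3, hη3, H3⟩ := h₃ hEos
  refine ⟨min ηs (min η1 (min η2 η3)), lt_min hηs (lt_min hη1 (lt_min hη2 hη3)), ?_⟩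
  intro η₁ hη₁ hη₁c ca cθ cu hca hcθ
  have hs : η₁ < ηs := lt_of_lt_of_le hη₁c (min_le_left _ _)
  have e1 : η₁ < η1 := lt_of_lt_of_le hη₁c ((min_le_right _ _).trans (min_le_left _ _))
  have e2 : η₁ < η2 := lt_of_lt_of_le hη₁c ((min_le_right _ _).trans ((min_le_right _ _).trans (min_le_left _ _)))
  have e3 : η₁ < η3 := lt_of_lt_of_le hη₁c ((min_le_right _ _).trans ((min_le_right _ _).trans (min_le_right _ _)))
  obtain ⟨σ1, hσ1, G1⟩ := H1 η₁ hη₁ e1 ca cθ cu hca hcθ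
  obtain ⟨σ2, hσ2, G2⟩ := H2 η₁ hη₁ e2 ca cθ cu hca hcθ
  obtain ⟨σ3, hσ3, G3⟩ := H3 η₁ hη₁ e3 ca cθ cu hca hcθ
  refine ⟨min σs (min σ1 (min σ2 σ3)), lt_min hσs (lt_min hσ1 (lt_min hσ2 hσ3)), ?_⟩
  intro σ hσ hσlt T cρ cϑ cv hsol hguard Φ hLLN ℓ hℓ hℓ0 hℓ3 τ hτ a b hab φ hφ hφ0
  have ss : σ < σs := lt_of_lt_of_le hσlt (min_le_left _ _)
  have s1 : σ < σ1 := lt_of_lt_of_le hσlt ((min_le_right _ _).trans (min_le_left _ _))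
  have s2 : σ < σ2 := lt_of_lt_of_le hσlt ((min_le_right _ _).trans ((min_le_right _ _).trans (min_le_left _ _)))
  have s3 : σ < σ3 := lt_of_lt_of_le hσlt ((min_le_right _ _).trans ((min_le_right _ _).trans (min_le_right _ _)))
  exact h σ η₁ ca cθ cu T cρ cϑ cv Φ ℓ τ a b φ hη₁ hs hca hcθ hσ ss hsol hguard hLLN hℓ hℓ0 hℓ3 hτ hab hφ hφ0
    (G1 σ hσ s1 T cρ cϑ cv hsol hguard Φ hLLN ℓ hℓ hℓ0 hℓ3 τ hτ a b hab φ hφ hφ0)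
    (G2 σ hσ s2 T cρ cϑ cv hsol hguard Φ hLLN ℓ hℓ hℓ0 hℓ3 τ hτ a b hab φ hφ hφ0)
    (G3 σ hσ s3 T cρ cϑ cv hsol hguard Φ hLLN ℓ hℓ hℓ0 hℓ3 τ hτ a b hab φ hφ hφ0)

/-- **Sub-frame bookkeeping (arity 2).** -/
theorem InFrameConst.mono₂ {C₁ C₂ C₃ : Conclusion} {ηs σs : ℝ} (hηs : 0 < ηs) (hσs : 0 < σs)
    (h : ∀ (σ η₁ ca cθ : ℝ) (cu : V3) (T cρ cϑ : ℝ) (cv : V3) (Φ : FlowFamily σ) (ℓ : ℕ → ℝ) (τ a b : ℝ)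
      (φ : ℝ → T3 → ℝ),
      0 < η₁ → η₁ < ηs → 0 < ca → 0 < cθ → 0 < σ → σ < σs →
      IsHardSphereEulerSolution σ T (fun _ _ => cρ) (fun _ _ => cv) (fun _ _ => cϑ) →
      (∀ t ∈ Ico 0 T, ∀ _x : T3, cρ * σ ^ 3 ≤ η₁ / 2) →
      TendstoHydroFieldsAt (fun N => localGibbsLaw σ (fun _ => ca) (fun _ => cu) (fun _ => cθ) N (Φ N)) Φ
        (fun _ _ => cρ) (fun _ _ => cv) (fun _ _ => cϑ) 0 →
      (∀ N, 0 < ℓ N ∧ ℓ N ≤ 1) → Tendsto ℓ atTop (𝓝 0) → Tendsto (fun N : ℕ => ℓ N ^ 3 * ((N : ℝ) + 1)) atTop atTop →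
      τ ∈ Ico 0 T → a < b → Literature.Analysis.FunctionSpaces.Torus.IsSmoothSpaceTimeOn (Ico 0 T) φ →
      (∀ t ∈ Icc 0 τ, ∀ x, 0 ≤ φ t x) →
      C₁ σ η₁ (fun _ => ca) (fun _ => cθ) (fun _ => cu) T (fun _ _ => cρ) (fun _ _ => cϑ) (fun _ _ => cv) Φ ℓ τ a b φ →
      C₂ σ η₁ (fun _ => ca) (fun _ => cθ) (fun _ => cu) T (fun _ _ => cρ) (fun _ _ => cϑ) (fun _ _ => cv) Φ ℓ τ a b φ →
      C₃ σ η₁ (fun _ => ca) (fun _ => cθ) (fun _ => cu) T (fun _ _ => cρ) (fun _ _ => cϑ) (fun _ _ => cv) Φ ℓ τ a b φ)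
    (h₁ : InFrameConst C₁) (h₂ : InFrameConst C₂) : InFrameConst C₃ :=
  InFrameConst.mono₃ (C₃ := fun _ _ _ _ _ _ _ _ _ _ _ _ _ _ _ => True) hηs hσs
    (fun σ η₁ ca cθ cu T cρ cϑ cv Φ ℓ τ a b φ hη₁ hs hca hcθ hσ ss hsol hguard hLLN hℓ hℓ0 hℓ3 hτ hab hφ hφ0 c₁ c₂ _ =>
      h σ η₁ ca cθ cu T cρ cϑ cv Φ ℓ τ a b φ hη₁ hs hca hcθ hσ ss hsol hguard hLLN hℓ hℓ0 hℓ3 hτ hab hφ hφ0 c₁ c₂)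
    h₁ h₂ InFrameConst.of_true

/-- **S1b holds at global equilibrium** (the heart on the sub-frame): `E[A_N] + B ≤ E|A_N + B| → 0` (GE, S1a). -/
theorem inFrameConst_def : InFrameConst Cdef := by
  refine InFrameConst.mono₂ (C₁ := CdynAbs) (C₂ := Cint) one_pos one_half_pos ?_ inFrameConst_dynAbs
    (InFrameConst.of_inFrame inFrame_int)
  intro σ η₁ ca cθ cu T cρ cϑ cv Φ ℓ τ a b φ _ _ hca hcθ _ ss _ _ _ _ _ _ _ _ _ _ c₁ c₂ ε hε
  haveI hP : ∀ N, IsProbabilityMeasure (localGibbsLaw σ (fun _ => ca) (fun _ => cu) (fun _ => cθ) N (Φ N)) :=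
    fun N => isProbabilityMeasure_localGibbsLaw continuous_const continuous_const continuous_const (fun _ => hca)
      (fun _ => hcθ) ss.le N (Φ N)
  filter_upwards [ENNReal.tendsto_nhds_zero.1 c₁ (ENNReal.ofReal ε) (ENNReal.ofReal_pos.2 hε)] with N hN
  have hint : Integrable (dynPart σ η₁ T ℓ Φ τ a b φ N)
      (localGibbsLaw σ (fun _ => ca) (fun _ => cu) (fun _ => cθ) N (Φ N)) := c₂ N
  have hAB := hint.add (integrable_const (initLimit σ η₁ (fun _ _ => cρ) (fun _ _ => cϑ) a b φ))
  calc (∫ z, dynPart σ η₁ T ℓ Φ τ a b φ N z ∂(localGibbsLaw σ (fun _ => ca) (fun _ => cu) (fun _ => cθ) N (Φ N))) +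
        initLimit σ η₁ (fun _ _ => cρ) (fun _ _ => cϑ) a b φ
      = ∫ z, (dynPart σ η₁ T ℓ Φ τ a b φ N z + initLimit σ η₁ (fun _ _ => cρ) (fun _ _ => cϑ) a b φ)
          ∂(localGibbsLaw σ (fun _ => ca) (fun _ => cu) (fun _ => cθ) N (Φ N)) := by
        rw [integral_add hint (integrable_const _), integral_const, probReal_univ, one_smul]
    _ ≤ ∫ z, |dynPart σ η₁ T ℓ Φ τ a b φ N z + initLimit σ η₁ (fun _ _ => cρ) (fun _ _ => cϑ) a b φ|
          ∂(localGibbsLaw σ (fun _ => ca) (fun _ => cu) (fun _ => cθ) N (Φ N)) :=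
        integral_mono hAB hAB.abs fun z => le_abs_self _
    _ = (∫⁻ z, ENNReal.ofReal |dynPart σ η₁ T ℓ Φ τ a b φ N z + initLimit σ η₁ (fun _ _ => cρ) (fun _ _ => cϑ) a b φ|
          ∂(localGibbsLaw σ (fun _ => ca) (fun _ => cu) (fun _ => cθ) N (Φ N))).toReal :=
        integral_eq_lintegral_of_nonneg_ae (Eventually.of_forall fun z => abs_nonneg _) hAB.abs.aestronglyMeasurable
    _ ≤ ε := by
        have h := ENNReal.toReal_mono ENNReal.ofReal_ne_top hN
        rwa [ENNReal.toReal_ofReal hε.le] at h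

/-- **S2 holds at global equilibrium** (no anomalous entropy fluctuations on the sub-frame): `E|A_N − E A_N| ≤ 2 E|A_N + B| → 0`. -/
theorem inFrameConst_conc : InFrameConst Cconc := by
  refine InFrameConst.mono₂ (C₁ := CdynAbs) (C₂ := Cint) one_pos one_half_pos ?_ inFrameConst_dynAbs
    (InFrameConst.of_inFrame inFrame_int)
  intro σ η₁ ca cθ cu T cρ cϑ cv Φ ℓ τ a b φ _ _ hca hcθ _ ss _ _ _ _ _ _ _ _ _ _ c₁ c₂
  haveI hP : ∀ N, IsProbabilityMeasure (localGibbsLaw σ (fun _ => ca) (fun _ => cu) (fun _ => cθ) N (Φ N)) :=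
    fun N => isProbabilityMeasure_localGibbsLaw continuous_const continuous_const continuous_const (fun _ => hca)
      (fun _ => hcθ) ss.le N (Φ N)
  have h2 := ENNReal.Tendsto.const_mul c₁ (Or.inr ENNReal.ofNat_ne_top) (a := 2)
  rw [mul_zero] at h2
  refine tendsto_of_tendsto_of_tendsto_of_le_of_le' tendsto_const_nhds h2 (Eventually.of_forall fun N => bot_le)
    (Eventually.of_forall fun N => ?_)
  have h := lintegral_ofReal_abs_sub_integral_le
    (localGibbsLaw σ (fun _ => ca) (fun _ => cu) (fun _ => cθ) N (Φ N)) (c₂ N)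
    (-initLimit σ η₁ (fun _ _ => cρ) (fun _ _ => cϑ) a b φ)
  simpa only [sub_neg_eq_add] using h

/-- **DynCore holds at global equilibrium**: `E[(A_N + B)⁺] ≤ E|A_N + B| → 0`. -/
theorem inFrameConst_dyn : InFrameConst Cdyn := by
  refine InFrameConst.mono₂ (C₁ := CdynAbs) (C₂ := fun _ _ _ _ _ _ _ _ _ _ _ _ _ _ _ => True) one_pos one_pos ?_
    inFrameConst_dynAbs InFrameConst.of_true
  intro σ η₁ ca cθ cu T cρ cϑ cv Φ ℓ τ a b φ _ _ _ _ _ _ _ _ _ _ _ _ _ _ _ _ c₁ _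
  exact tendsto_of_tendsto_of_tendsto_of_le_of_le' tendsto_const_nhds c₁ (Eventually.of_forall fun N => bot_le)
    (Eventually.of_forall fun N => lintegral_mono fun z => ENNReal.ofReal_le_ofReal (le_abs_self _))

/-- **The crux's own conclusion holds at global equilibrium**: `E_{P_N}[(Q_N)⁺] → 0` on the sub-frame
(`(A + B_N)⁺ ≤ (A + B)⁺ + |B_N − B|`, DynCore at global equilibrium, S0). This is `Ccrux` — the `let`-bound functional of
`BoxDissipativeWeakStrong.EntropyAdmissibility` (`entropyAdmissibility_iff_inFrame : crux ↔ InFrame Ccrux` is `Iff.rfl`) — on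
the sub-frame `InFrameConst` of constant profiles and constant Euler states; `inFrameConst_crux_of_crux` is the converse bookkeeping. -/
theorem inFrameConst_crux : InFrameConst Ccrux := by
  obtain ⟨η₀, hη₀, F, hFan, hFeq, -⟩ := BoxDissipativeWeakStrong.HsEosLowDensity_holds
  have hcont : ContinuousOn hsExcessFreeEnergy (Ico 0 η₀) :=
    (hFan.continuousOn.mono fun η hη => ⟨(neg_lt_zero.2 hη₀).trans_le hη.1, hη.2⟩).congr hFeq
  refine InFrameConst.mono₂ (C₁ := Cdyn) (C₂ := Cstat) hη₀ one_half_pos ?_ inFrameConst_dyn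
    (InFrameConst.of_inFrame inFrame_stat)
  intro σ η₁ ca cθ cu T cρ cϑ cv Φ ℓ τ a b φ hη₁ hs hca hcθ hσ ss _ _ _ hℓ _ _ hτ hab hφ _ c₁ c₂
  haveI hP : ∀ N, IsProbabilityMeasure (localGibbsLaw σ (fun _ => ca) (fun _ => cu) (fun _ => cθ) N (Φ N)) :=
    fun N => isProbabilityMeasure_localGibbsLaw continuous_const continuous_const continuous_const (fun _ => hca)
      (fun _ => hcθ) ss.le N (Φ N)
  have hT : 0 < T := lt_of_le_of_lt hτ.1 hτ.2
  refine tendsto_lintegral_ofReal_of_le_add (fun N => localGibbsLaw σ (fun _ => ca) (fun _ => cu) (fun _ => cθ) N (Φ N))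
    (fun N z => dynPart σ η₁ T ℓ Φ τ a b φ N z + initPart σ η₁ ℓ Φ a b φ N z)
    (fun N z => dynPart σ η₁ T ℓ Φ τ a b φ N z + initLimit σ η₁ (fun _ _ => cρ) (fun _ _ => cϑ) a b φ)
    (fun N z => |initPart σ η₁ ℓ Φ a b φ N z - initLimit σ η₁ (fun _ _ => cρ) (fun _ _ => cϑ) a b φ|) (fun N z => ?_)
    (fun N => aemeasurable_ofReal_abs_initPart_sub hcont hσ.le hη₁.le hs Φ (hℓ N).1 hT hab.le hφ _ _) c₁ c₂
  have := le_abs_self (initPart σ η₁ ℓ Φ a b φ N z - initLimit σ η₁ (fun _ _ => cρ) (fun _ _ => cϑ) a b φ)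
  linarith


/-! ## The registered bookkeeping stub -/

/-- Signature of the registered bookkeeping stub `stub_globalEquilibriumConclusions` (verbatim the skeleton's, r10): on the
global-equilibrium sub-frame S1b (`Cdef`), S2 (`Cconc`), DynCore (`Cdyn`) and the crux's conclusion (`Ccrux`) hold; the crux implies its
global-equilibrium instance; every frame statement specialises to the sub-frame. -/
def Sig.stub_globalEquilibriumConclusions : Prop :=
  InFrameConst Cdef ∧ InFrameConst Cconc ∧ InFrameConst Cdyn ∧ InFrameConst Ccrux ∧
    (BoxDissipativeWeakStrong.EntropyAdmissibility → InFrameConst Ccrux) ∧ (∀ C : Conclusion, InFrame C → InFrameConst C)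

/-- **Registered bookkeeping stub `stub_globalEquilibriumConclusions`** (crux stmt-AtomisticToContinuum-9903, line `registered`, r10):
the crux `EntropyAdmissibility` — together with its open heart S1b and the open fluctuation statement S2 — HOLDS AT GLOBAL EQUILIBRIUM. -/
theorem stub_globalEquilibriumConclusions : Sig.stub_globalEquilibriumConclusions :=
  ⟨inFrameConst_def, inFrameConst_conc, inFrameConst_dyn, inFrameConst_crux, inFrameConst_crux_of_crux,
    fun _ h => InFrameConst.of_inFrame h⟩

end Summit.AtomisticToContinuum.HydrodynamicLimit.Theorems.EABirthGE

end
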